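import Summits.QuantumFields.YangMills.Theorems.SandwichVariancePinchingScoreIdentities

/-!
# Route `SandwichVariancePinching` — SECOND MOMENT OF THE AFFINE SCORE and the AFFINE-DUAL VARIANCE
# INEQUALITY (engine of crux `QuadraticVarianceFloor`, stmt-QuantumFields-28260; also used by the ceiling 28259)

For a `C²` potential `A` on `ℝⁿ` under the whitened sandwich `(1−δ)|h|² ≤ A(x+h)+A(x−h)−2A(x) ≤ (1+δ)|h|²`
(`0 ≤ δ < 1`), an affine field `u(x) = Mx + m` and its score `G_u = ∂_u A − tr M`:

  (I2)  `∫ G_u² e^{−A} = tr(M²)·∫e^{−A} + ∫ D²A(u,u) e^{−A}`            (`integral_score_sq`)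
  (V)   `2∫ ∂_uF e^{−A} − tr(M²)∫e^{−A} − (1+δ)∫|u|² e^{−A} ≤ ∫ (F − c)² e^{−A}`   (`affine_dual_ineq`)

for every `C¹` observable `F` of polynomial growth and every constant `c` — (V) is `0 ≤ ∫(F − c − G_u)²e^{−A}`
expanded with (I1), (I2) and the pointwise Hessian bound `D²A(u,u) ≤ (1+δ)|u|²` that the sandwich forces on a
`C²` potential.  With `F` linear and `u` constant, (V) is the Cramér–Rao covariance floor `Σ ⪰ (1+δ)⁻¹·1`;
with `F = q = xᵀHx + bᵀx` and `u = Hx + b/(1+δ)` it is the variance floor `Var q ≥ (1 − 2δ)·(2trH² + |b|²)`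
(planner ym-idea-3 g13, PROOF-PLANS §g13; assembled in the sibling file `…FloorWhitenedSmooth`).  No
Brascamp–Lieb, no Helffer–Sjöstrand, no transport.

HONEST SCOPE.  Helper lemmas (free-hands work of the LEAD seat of crux stmt-QuantumFields-22884, cell
ym-idea-1) toward the SVP cruxes 28260/28259; nothing here proves either crux, `QuadraticCovarianceComparison`
(26240), the `LogConcaveChart` thesis, rung R2a or any summit statement; the Yang–Mills mass gap is NOT
proved by any of this.
-/

noncomputable section

namespace Summit.QuantumFields.YangMills.Theorems.SandwichVariancePinching

open MeasureTheory Real Filter Topology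

variable {n : ℕ}

/-- **SECOND MOMENT OF THE AFFINE SCORE**: for `u(x) = Mx + m` and `G_u = ∂_u A − tr M`,
`∫ G_u² e^{−A} = tr(M²)·∫e^{−A} + ∫ D²A(u,u) e^{−A}`. [folklore] -/
theorem integral_score_sq {A : (Fin n → ℝ) → ℝ} (hA : ContDiff ℝ 2 A) {δ : ℝ}
    (hδ : 0 ≤ δ) (hδ1 : δ < 1)
    (hsw : ∀ x h : Fin n → ℝ, (1 - δ) * (h ⬝ᵥ h) ≤ A (x + h) + A (x - h) - 2 * A x ∧
      A (x + h) + A (x - h) - 2 * A x ≤ (1 + δ) * (h ⬝ᵥ h))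
    (M : Matrix (Fin n) (Fin n) ℝ) (m : Fin n → ℝ) :
    ∫ x, (fderiv ℝ A x (M.mulVec x + m) - M.trace) ^ 2 * exp (-A x) =
      (M * M).trace * (∫ x, exp (-A x)) +
        ∫ x, fderiv ℝ (fderiv ℝ A) x (M.mulVec x + m) (M.mulVec x + m) * exp (-A x) := by
  have hAc : Continuous A := hA.continuous
  obtain ⟨C₀, κ, _, hκ, hlb⟩ := exists_quadratic_lower_of_sandwich hAc hδ1 hsw
  -- the score and its growth
  set G : (Fin n → ℝ) → ℝ := fun x => fderiv ℝ A x (M.mulVec x + m) - M.trace with hGdef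
  have hGc : ContDiff ℝ 1 G := (contDiff_fderiv_affine hA M m).sub contDiff_const
  obtain ⟨D₁, hD₁0, hD₁⟩ := exists_abs_fderiv_affine_le hA hδ hsw M m
  have hGb : ∀ x, |G x| ≤ (D₁ + |M.trace|) * (1 + ‖x‖) ^ 3 := fun x => by
    have h1 := hD₁ x
    have h2 : (1:ℝ) ≤ (1 + ‖x‖) ^ 3 := one_le_pow₀ (by linarith [norm_nonneg x])
    calc |G x| ≤ |fderiv ℝ A x (M.mulVec x + m)| + |M.trace| := abs_sub _ _
      _ ≤ D₁ * (1 + ‖x‖) ^ 3 + |M.trace| * (1 + ‖x‖) ^ 3 :=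
          add_le_add h1 (le_mul_of_one_le_right (abs_nonneg _) h2)
      _ = (D₁ + |M.trace|) * (1 + ‖x‖) ^ 3 := by ring
  -- partials of the score
  have hGd : ∀ x v, fderiv ℝ G x v =
      fderiv ℝ A x (M.mulVec v) + fderiv ℝ (fderiv ℝ A) x v (M.mulVec x + m) := by
    intro x v
    obtain ⟨L, hL, hLv⟩ := hasFDerivAt_fderiv_affine hA M m x
    have h : HasFDerivAt G L x := by
      have := hL.sub_const M.trace
      exact this
    rw [h.fderiv, hLv]
  have hG'b : ∃ D : ℝ, ∀ x (j : Fin n), |fderiv ℝ G x (Pi.single j 1)| ≤ D * (1 + ‖x‖) ^ 2 := by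
    have h := fun j : Fin n => exists_abs_fderiv_fderiv_affine_le hA hδ hsw M m (Pi.single j 1)
    choose Dj hDj0 hDj using h
    refine ⟨∑ j, Dj j, fun x j => ?_⟩
    rw [hGd]
    have h1 := hDj j x
    rw [(hasFDerivAt_fderiv_affine hA M m x).choose_spec.1.fderiv,
      (hasFDerivAt_fderiv_affine hA M m x).choose_spec.2] at h1
    exact h1.trans (mul_le_mul_of_nonneg_right
      (Finset.single_le_sum (fun i _ => hDj0 i) (Finset.mem_univ j)) (by positivity))
  obtain ⟨D₂, hD₂⟩ := hG'b
  -- (a) `∫ G·∂_uA·e^{−A} = ∫ (∂_uG + trM·G) e^{−A}`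
  have ha := integral_mul_fderiv_affine_mul_exp_neg hA hδ hδ1 hsw M m hGc hGb hD₂
  -- integrability facts
  obtain ⟨D₃, _, hD₃⟩ := exists_abs_fderiv_affine_le hA hδ hsw (M * M) (M.mulVec m)
  have hI_G : Integrable fun x => G x * exp (-A x) :=
    integrable_mul_exp_neg_of_growth hAc hGc.continuous hκ (by norm_num) hlb hGb
  have hI_GdA : Integrable fun x => G x * fderiv ℝ A x (M.mulVec x + m) * exp (-A x) :=
    integrable_mul_exp_neg_of_growth hAc (hGc.continuous.mul (contDiff_fderiv_affine hA M m).continuous)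
      hκ (by norm_num : 3 + 3 ≤ 8) hlb (abs_mul_le_growth hGb hD₁)
  have huu : ∀ x, M.mulVec (M.mulVec x + m) = (M * M).mulVec x + M.mulVec m := fun x => by
    rw [Matrix.mulVec_add, Matrix.mulVec_mulVec]
  have hI_dMu : Integrable fun x => fderiv ℝ A x (M.mulVec (M.mulVec x + m)) * exp (-A x) := by
    simp_rw [huu]
    exact integrable_mul_exp_neg_of_growth hAc (contDiff_fderiv_affine hA (M * M) (M.mulVec m)).continuous
      hκ (by norm_num) hlb hD₃
  have hI_hess : Integrable fun x =>
      fderiv ℝ (fderiv ℝ A) x (M.mulVec x + m) (M.mulVec x + m) * exp (-A x) := by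
    obtain ⟨C, hC0, hC⟩ := exists_norm_affine_le M m
    refine integrable_mul_exp_neg_of_growth hAc
      (continuous_fderiv_fderiv_apply_of_contDiff hA (contDiff_affine M m).continuous
        (contDiff_affine M m).continuous) hκ (by norm_num : 2 ≤ 8) hlb
      (D := (1 + δ) / 2 * ((n : ℝ) * C ^ 2 + (n : ℝ) * C ^ 2)) fun x => ?_
    have h := abs_fderiv_fderiv_le_norm hA hsw hδ x (M.mulVec x + m) (M.mulVec x + m)
    have h3 : ‖M.mulVec x + m‖ ^ 2 ≤ C ^ 2 * (1 + ‖x‖) ^ 2 := by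
      rw [← mul_pow]; exact pow_le_pow_left₀ (norm_nonneg _) (hC x) 2
    have hn : (0:ℝ) ≤ n := Nat.cast_nonneg n
    calc |fderiv ℝ (fderiv ℝ A) x (M.mulVec x + m) (M.mulVec x + m)|
        ≤ (1 + δ) / 2 * ((n : ℝ) * ‖M.mulVec x + m‖ ^ 2 + (n : ℝ) * ‖M.mulVec x + m‖ ^ 2) := h
      _ ≤ (1 + δ) / 2 * ((n : ℝ) * (C ^ 2 * (1 + ‖x‖) ^ 2) + (n : ℝ) * (C ^ 2 * (1 + ‖x‖) ^ 2)) := by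
          have hb := mul_le_mul_of_nonneg_left h3 hn
          have hd : 0 ≤ (1 + δ) / 2 := by positivity
          exact mul_le_mul_of_nonneg_left (add_le_add hb hb) hd
      _ = (1 + δ) / 2 * ((n : ℝ) * C ^ 2 + (n : ℝ) * C ^ 2) * (1 + ‖x‖) ^ 2 := by ring
  -- (d) `∫ ∂_{Mu}A e^{−A} = tr(M²) Z`
  have hd : ∫ x, fderiv ℝ A x (M.mulVec (M.mulVec x + m)) * exp (-A x) =
      (M * M).trace * ∫ x, exp (-A x) := by
    have h1 := integral_mul_fderiv_affine_mul_exp_neg hA hδ hδ1 hsw (M * M) (M.mulVec m)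
      (F := fun _ => (1:ℝ)) contDiff_const (DF := 1) (DF' := 0)
      (fun x => by
        rw [abs_one, one_mul]; exact one_le_pow₀ (by linarith [norm_nonneg x]))
      (fun x j => by simp)
    simp only [one_mul, fderiv_fun_const, Pi.zero_apply, zero_apply, zero_add, mul_one] at h1
    simp_rw [huu]
    rw [h1, integral_const_mul]
  -- (b) assemble: `G² = G·∂_uA − trM·G`
  have hsq : ∀ x, G x ^ 2 * exp (-A x) =
      G x * fderiv ℝ A x (M.mulVec x + m) * exp (-A x) - M.trace * (G x * exp (-A x)) := fun x => by
    simp only [hGdef]; ring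
  have hG2 : (fun x => (fderiv ℝ A x (M.mulVec x + m) - M.trace) ^ 2 * exp (-A x)) =
      fun x => G x * fderiv ℝ A x (M.mulVec x + m) * exp (-A x) - M.trace * (G x * exp (-A x)) := by
    funext x; exact hsq x
  rw [hG2, integral_sub hI_GdA (hI_G.const_mul _), integral_const_mul, ha]
  -- `∫ (∂_uG + trM G) e^{−A} = ∫ ∂_uG e^{−A} + trM ∫ G e^{−A}`
  have hsplit : (fun x => (fderiv ℝ G x (M.mulVec x + m) + M.trace * G x) * exp (-A x)) =
      fun x => (fderiv ℝ A x (M.mulVec (M.mulVec x + m)) * exp (-A x) +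
        fderiv ℝ (fderiv ℝ A) x (M.mulVec x + m) (M.mulVec x + m) * exp (-A x)) +
        M.trace * (G x * exp (-A x)) := by
    funext x; rw [hGd]; ring
  have hI1 : Integrable fun x => fderiv ℝ A x (M.mulVec (M.mulVec x + m)) * exp (-A x) +
      fderiv ℝ (fderiv ℝ A) x (M.mulVec x + m) (M.mulVec x + m) * exp (-A x) := hI_dMu.add hI_hess
  have hI2 : Integrable fun x => M.trace * (G x * exp (-A x)) := hI_G.const_mul _
  rw [hsplit, integral_add hI1 hI2, integral_add hI_dMu hI_hess, integral_const_mul, hd]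
  ring


/-- **THE AFFINE-DUAL (variational / Cramér–Rao type) VARIANCE INEQUALITY.** For a `C²` potential
with the whitened sandwich, an affine field `u(x) = Mx + m`, a `C¹` observable `F` of polynomial
growth and any constant `c`:
`2∫ ∂_uF e^{−A} − tr(M²)∫e^{−A} − (1+δ)∫|u|² e^{−A} ≤ ∫ (F − c)² e^{−A}`
(expand `0 ≤ ∫ (F − c − G_u)² e^{−A}` with the score identities and `D²A ≤ (1+δ)·1`). [folklore] -/
theorem affine_dual_ineq {A : (Fin n → ℝ) → ℝ} (hA : ContDiff ℝ 2 A) {δ : ℝ}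
    (hδ : 0 ≤ δ) (hδ1 : δ < 1)
    (hsw : ∀ x h : Fin n → ℝ, (1 - δ) * (h ⬝ᵥ h) ≤ A (x + h) + A (x - h) - 2 * A x ∧
      A (x + h) + A (x - h) - 2 * A x ≤ (1 + δ) * (h ⬝ᵥ h))
    (M : Matrix (Fin n) (Fin n) ℝ) (m : Fin n → ℝ) {F : (Fin n → ℝ) → ℝ} (hF : ContDiff ℝ 1 F)
    {DF DF' : ℝ} (hFb : ∀ x, |F x| ≤ DF * (1 + ‖x‖) ^ 3)
    (hF'b : ∀ x (j : Fin n), |fderiv ℝ F x (Pi.single j 1)| ≤ DF' * (1 + ‖x‖) ^ 2) (c : ℝ) :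
    2 * (∫ x, fderiv ℝ F x (M.mulVec x + m) * exp (-A x)) - (M * M).trace * (∫ x, exp (-A x))
      - (1 + δ) * (∫ x, ((M.mulVec x + m) ⬝ᵥ (M.mulVec x + m)) * exp (-A x))
      ≤ ∫ x, (F x - c) ^ 2 * exp (-A x) := by
  have hAc : Continuous A := hA.continuous
  obtain ⟨C₀, κ, _, hκ, hlb⟩ := exists_quadratic_lower_of_sandwich hAc hδ1 hsw
  set G : (Fin n → ℝ) → ℝ := fun x => fderiv ℝ A x (M.mulVec x + m) - M.trace with hGdef
  have hGc : ContDiff ℝ 1 G := (contDiff_fderiv_affine hA M m).sub contDiff_const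
  obtain ⟨D₁, hD₁0, hD₁⟩ := exists_abs_fderiv_affine_le hA hδ hsw M m
  have hGb : ∀ x, |G x| ≤ (D₁ + |M.trace|) * (1 + ‖x‖) ^ 3 := fun x => by
    have h1 := hD₁ x
    have h2 : (1:ℝ) ≤ (1 + ‖x‖) ^ 3 := one_le_pow₀ (by linarith [norm_nonneg x])
    calc |G x| ≤ |fderiv ℝ A x (M.mulVec x + m)| + |M.trace| := abs_sub _ _
      _ ≤ D₁ * (1 + ‖x‖) ^ 3 + |M.trace| * (1 + ‖x‖) ^ 3 :=
          add_le_add h1 (le_mul_of_one_le_right (abs_nonneg _) h2)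
      _ = (D₁ + |M.trace|) * (1 + ‖x‖) ^ 3 := by ring
  -- the shifted observable `F − c`
  have hFc : ContDiff ℝ 1 (fun x => F x - c) := hF.sub contDiff_const
  have hFcb : ∀ x, |F x - c| ≤ (DF + |c|) * (1 + ‖x‖) ^ 3 := fun x => by
    have h2 : (1:ℝ) ≤ (1 + ‖x‖) ^ 3 := one_le_pow₀ (by linarith [norm_nonneg x])
    calc |F x - c| ≤ |F x| + |c| := abs_sub _ _
      _ ≤ DF * (1 + ‖x‖) ^ 3 + |c| * (1 + ‖x‖) ^ 3 :=
          add_le_add (hFb x) (le_mul_of_one_le_right (abs_nonneg _) h2)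
      _ = (DF + |c|) * (1 + ‖x‖) ^ 3 := by ring
  have hFcd : ∀ x, fderiv ℝ (fun y => F y - c) x = fderiv ℝ F x := fun x => fderiv_sub_const c
  have hFc'b : ∀ x (j : Fin n), |fderiv ℝ (fun y => F y - c) x (Pi.single j 1)| ≤ DF' * (1 + ‖x‖) ^ 2 :=
    fun x j => by rw [hFcd]; exact hF'b x j
  -- the norm of the field
  obtain ⟨Cu, hCu0, hCu⟩ := exists_norm_affine_le M m
  have huub : ∀ x, |(M.mulVec x + m) ⬝ᵥ (M.mulVec x + m)| ≤ (n : ℝ) * Cu ^ 2 * (1 + ‖x‖) ^ 2 := by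
    intro x
    rw [abs_of_nonneg (by simpa using dotProduct_self_star_nonneg (M.mulVec x + m))]
    have h1 := dotProduct_self_le_card_mul_norm_sq (M.mulVec x + m)
    have h3 : ‖M.mulVec x + m‖ ^ 2 ≤ Cu ^ 2 * (1 + ‖x‖) ^ 2 := by
      rw [← mul_pow]; exact pow_le_pow_left₀ (norm_nonneg _) (hCu x) 2
    have hn : (0:ℝ) ≤ n := Nat.cast_nonneg n
    nlinarith [mul_le_mul_of_nonneg_left h3 hn]
  -- integrability
  have hIuu : Integrable fun x => ((M.mulVec x + m) ⬝ᵥ (M.mulVec x + m)) * exp (-A x) :=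
    integrable_mul_exp_neg_of_growth hAc (((contDiff_affine M m).continuous).dotProduct
      (contDiff_affine M m).continuous) hκ (by norm_num) hlb huub
  have hIhess : Integrable fun x =>
      fderiv ℝ (fderiv ℝ A) x (M.mulVec x + m) (M.mulVec x + m) * exp (-A x) := by
    refine integrable_mul_exp_neg_of_growth hAc
      (continuous_fderiv_fderiv_apply_of_contDiff hA (contDiff_affine M m).continuous
        (contDiff_affine M m).continuous) hκ (by norm_num : 2 ≤ 8) hlb
      (D := (1 + δ) / 2 * ((n : ℝ) * Cu ^ 2 + (n : ℝ) * Cu ^ 2)) fun x => ?_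
    have h := abs_fderiv_fderiv_le_norm hA hsw hδ x (M.mulVec x + m) (M.mulVec x + m)
    have h3 : ‖M.mulVec x + m‖ ^ 2 ≤ Cu ^ 2 * (1 + ‖x‖) ^ 2 := by
      rw [← mul_pow]; exact pow_le_pow_left₀ (norm_nonneg _) (hCu x) 2
    have hn : (0:ℝ) ≤ n := Nat.cast_nonneg n
    have hb := mul_le_mul_of_nonneg_left h3 hn
    have hd : 0 ≤ (1 + δ) / 2 := by positivity
    calc |fderiv ℝ (fderiv ℝ A) x (M.mulVec x + m) (M.mulVec x + m)|
        ≤ (1 + δ) / 2 * ((n : ℝ) * ‖M.mulVec x + m‖ ^ 2 + (n : ℝ) * ‖M.mulVec x + m‖ ^ 2) := h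
      _ ≤ (1 + δ) / 2 * ((n : ℝ) * (Cu ^ 2 * (1 + ‖x‖) ^ 2) + (n : ℝ) * (Cu ^ 2 * (1 + ‖x‖) ^ 2)) :=
          mul_le_mul_of_nonneg_left (add_le_add hb hb) hd
      _ = (1 + δ) / 2 * ((n : ℝ) * Cu ^ 2 + (n : ℝ) * Cu ^ 2) * (1 + ‖x‖) ^ 2 := by ring
  have hI1 : Integrable fun x => (F x - c) ^ 2 * exp (-A x) := by
    have := abs_mul_le_growth hFcb hFcb
    refine integrable_mul_exp_neg_of_growth hAc ((hFc.continuous).pow 2) hκ (by norm_num : 3 + 3 ≤ 8)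
      hlb (D := (DF + |c|) * (DF + |c|)) (fun x => ?_)
    rw [sq]; exact this x
  have hI2 : Integrable fun x => (F x - c) * G x * exp (-A x) :=
    integrable_mul_exp_neg_of_growth hAc (hFc.continuous.mul hGc.continuous) hκ
      (by norm_num : 3 + 3 ≤ 8) hlb (abs_mul_le_growth hFcb hGb)
  have hI3 : Integrable fun x => G x ^ 2 * exp (-A x) := by
    have := abs_mul_le_growth hGb hGb
    refine integrable_mul_exp_neg_of_growth hAc ((hGc.continuous).pow 2) hκ (by norm_num : 3 + 3 ≤ 8)
      hlb (D := (D₁ + |M.trace|) * (D₁ + |M.trace|)) (fun x => ?_)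
    rw [sq]; exact this x
  have hI2dA : Integrable fun x => (F x - c) * fderiv ℝ A x (M.mulVec x + m) * exp (-A x) :=
    integrable_mul_exp_neg_of_growth hAc (hFc.continuous.mul (contDiff_fderiv_affine hA M m).continuous)
      hκ (by norm_num : 3 + 3 ≤ 8) hlb (abs_mul_le_growth hFcb hD₁)
  have hIFc : Integrable fun x => (F x - c) * exp (-A x) :=
    integrable_mul_exp_neg_of_growth hAc hFc.continuous hκ (by norm_num) hlb hFcb
  have hIdF : Integrable fun x => fderiv ℝ F x (M.mulVec x + m) * exp (-A x) := by
    have hc := fun j : Fin n => exists_abs_affine_apply_le M m j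
    choose Cj hCj0 hCj using hc
    have hCc : ∀ x, |fderiv ℝ F x (M.mulVec x + m)| ≤ (∑ j, Cj j * DF') * (1 + ‖x‖) ^ 3 := by
      intro x
      rw [clm_apply_eq_sum_single, Finset.sum_mul]
      refine (Finset.abs_sum_le_sum_abs _ _).trans (Finset.sum_le_sum fun j _ => ?_)
      rw [abs_mul]
      calc |(M.mulVec x + m) j| * |fderiv ℝ F x (Pi.single j 1)|
          ≤ (Cj j * (1 + ‖x‖)) * (DF' * (1 + ‖x‖) ^ 2) :=
            mul_le_mul (hCj j x) (hF'b x j) (abs_nonneg _) (mul_nonneg (hCj0 j) (by positivity))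
        _ = Cj j * DF' * (1 + ‖x‖) ^ 3 := by ring
    exact integrable_mul_exp_neg_of_growth hAc ((hF.continuous_fderiv one_ne_zero).clm_apply
      (contDiff_affine M m).continuous) hκ (by norm_num) hlb hCc
  -- (I1) for `F − c`
  have hI1id := integral_mul_fderiv_affine_mul_exp_neg hA hδ hδ1 hsw M m hFc hFcb hFc'b
  simp only [hFcd] at hI1id
  -- `∫ (F−c) G e^{−A} = ∫ ∂_uF e^{−A}`
  have hcross : ∫ x, (F x - c) * G x * exp (-A x) = ∫ x, fderiv ℝ F x (M.mulVec x + m) * exp (-A x) := by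
    have e1 : (fun x => (F x - c) * G x * exp (-A x)) = fun x =>
        (F x - c) * fderiv ℝ A x (M.mulVec x + m) * exp (-A x) - M.trace * ((F x - c) * exp (-A x)) := by
      funext x; simp only [hGdef]; ring
    have e2 : (fun x => (fderiv ℝ F x (M.mulVec x + m) + M.trace * (F x - c)) * exp (-A x)) =
        fun x => fderiv ℝ F x (M.mulVec x + m) * exp (-A x) + M.trace * ((F x - c) * exp (-A x)) := by
      funext x; ring
    rw [e1, integral_sub hI2dA (hIFc.const_mul _), hI1id, e2,
      integral_add hIdF (hIFc.const_mul _), integral_const_mul]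
    ring
  -- `∫ G² e^{−A} ≤ tr(M²) Z + (1+δ) ∫ |u|² e^{−A}`
  have hG2 := integral_score_sq hA hδ hδ1 hsw M m
  have hmono : ∫ x, fderiv ℝ (fderiv ℝ A) x (M.mulVec x + m) (M.mulVec x + m) * exp (-A x) ≤
      ∫ x, (1 + δ) * (((M.mulVec x + m) ⬝ᵥ (M.mulVec x + m)) * exp (-A x)) := by
    refine integral_mono hIhess (hIuu.const_mul _) fun x => ?_
    have h := fderiv_fderiv_le_of_secondDiff_le hA (fun y h => (hsw y h).2) x (M.mulVec x + m)
    have he : 0 ≤ exp (-A x) := (exp_pos _).le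
    simp only
    nlinarith
  rw [integral_const_mul] at hmono
  have hG2le : ∫ x, G x ^ 2 * exp (-A x) ≤ (M * M).trace * (∫ x, exp (-A x)) +
      (1 + δ) * ∫ x, ((M.mulVec x + m) ⬝ᵥ (M.mulVec x + m)) * exp (-A x) := by
    rw [show (fun x => G x ^ 2 * exp (-A x)) =
        fun x => (fderiv ℝ A x (M.mulVec x + m) - M.trace) ^ 2 * exp (-A x) from rfl, hG2]
    linarith
  -- expand the square
  have hnn : 0 ≤ ∫ x, (F x - c - G x) ^ 2 * exp (-A x) :=
    integral_nonneg fun x => mul_nonneg (sq_nonneg _) (exp_pos _).le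
  have hexp : (fun x => (F x - c - G x) ^ 2 * exp (-A x)) = fun x =>
      (F x - c) ^ 2 * exp (-A x) - 2 * ((F x - c) * G x * exp (-A x)) + G x ^ 2 * exp (-A x) := by
    funext x; ring
  have hI12 : Integrable fun x => (F x - c) ^ 2 * exp (-A x) - 2 * ((F x - c) * G x * exp (-A x)) :=
    hI1.sub (hI2.const_mul 2)
  rw [hexp, integral_add hI12 hI3, integral_sub hI1 (hI2.const_mul 2), integral_const_mul, hcross] at hnn
  linarith

end Summit.QuantumFields.YangMills.Theorems.SandwichVariancePinching

end
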